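import Mathlib
import Summits.Ventures.HodgeRepro2.JointEigenbasis

/-!
# SeparationQuotientOperators — operators with a formal adjoint descend to the separation
quotient of a pre-inner-product space

Blind cell `pub-hodge-repro2`, seat p2 (Tier 5 kernel support, Hecke side).

The Petersson product on the continuous weight-`k` functions on the ball (`PeterssonPreInner.lean`)
is only a PRE-inner product: a function vanishing on the ball has norm `0`. Mathlib's
`SeparationQuotient` of a seminormed inner product space is an honest inner product space
(`SeparationQuotient.instInnerProductSpace`). This file descends operators to it:

* an operator `T` with a formal adjoint `T'` (`⟪T x, y⟫ = ⟪x, T' y⟫`) maps null vectors to null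
  vectors (Cauchy–Schwarz: `‖T x‖² = ⟪x, T' (T x)⟫ ≤ ‖x‖ · ‖T' (T x)‖`);
* such a `T` descends to a linear map `descendSQ T` on the separation quotient, with
  `descendSQ T (mk x) = mk (T x)`;
* formal adjoint pairs and commutation descend.

Everything is Mathlib-level linear algebra; the Petersson instantiation is `PeterssonSpace.lean`.
-/

namespace Summit.Ventures.HodgeRepro2.SeparationQuotientOperators

open JointEigenbasis

variable {E : Type*} [SeminormedAddCommGroup E] [InnerProductSpace ℂ E]

/-- An operator with a formal adjoint maps null vectors to null vectors. -/
theorem norm_apply_eq_zero_of_adjoint (T T' : E →ₗ[ℂ] E)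
    (h : ∀ x y, inner ℂ (T x) y = inner ℂ x (T' y)) {x : E} (hx : ‖x‖ = 0) : ‖T x‖ = 0 := by
  have h1 : inner ℂ (T x) (T x) = inner ℂ x (T' (T x)) := h x (T x)
  have h2 : ‖inner ℂ x (T' (T x))‖ ≤ ‖x‖ * ‖T' (T x)‖ := norm_inner_le_norm _ _
  rw [hx, zero_mul] at h2
  have h3 : inner ℂ (T x) (T x) = 0 := by
    rw [h1]
    exact norm_le_zero_iff.mp h2
  have h4 : ‖T x‖ ^ 2 = 0 := by
    rw [norm_sq_eq_re_inner (𝕜 := ℂ), h3, map_zero]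
  exact pow_eq_zero_iff (two_ne_zero) |>.mp h4

/-- The descent of a linear map preserving null vectors to the separation quotient. -/
noncomputable def descendSQ (T : E →ₗ[ℂ] E) (hT : ∀ x, ‖x‖ = 0 → ‖T x‖ = 0) :
    SeparationQuotient E →ₗ[ℂ] SeparationQuotient E where
  toFun := SeparationQuotient.lift (fun x => SeparationQuotient.mk (T x)) (by
    intro x y hxy
    rw [SeparationQuotient.mk_eq_mk, Metric.inseparable_iff, dist_eq_norm, ← map_sub]
    rw [Metric.inseparable_iff, dist_eq_norm] at hxy
    exact hT _ hxy)
  map_add' := by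
    rintro ⟨x⟩ ⟨y⟩
    change SeparationQuotient.mk (T (x + y)) = SeparationQuotient.mk (T x) + SeparationQuotient.mk (T y)
    rw [map_add, SeparationQuotient.mk_add]
  map_smul' := by
    rintro c ⟨x⟩
    change SeparationQuotient.mk (T (c • x)) = c • SeparationQuotient.mk (T x)
    rw [map_smul, SeparationQuotient.mk_smul]

/-- `descendSQ T (mk x) = mk (T x)`. -/
@[simp]
theorem descendSQ_mk (T : E →ₗ[ℂ] E) (hT : ∀ x, ‖x‖ = 0 → ‖T x‖ = 0) (x : E) :
    descendSQ T hT (SeparationQuotient.mk x) = SeparationQuotient.mk (T x) := rfl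

/-- A formal adjoint pair descends to a formal adjoint pair on the separation quotient. -/
theorem isFormalAdjointPair_descendSQ (T T' : E →ₗ[ℂ] E)
    (h : ∀ x y, inner ℂ (T x) y = inner ℂ x (T' y)) (hT : ∀ x, ‖x‖ = 0 → ‖T x‖ = 0)
    (hT' : ∀ x, ‖x‖ = 0 → ‖T' x‖ = 0) :
    IsFormalAdjointPair (descendSQ T hT) (descendSQ T' hT') := by
  rintro ⟨x⟩ ⟨y⟩
  change inner ℂ (SeparationQuotient.mk (T x)) (SeparationQuotient.mk y)
    = inner ℂ (SeparationQuotient.mk x) (SeparationQuotient.mk (T' y))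
  rw [SeparationQuotient.inner_mk_mk, SeparationQuotient.inner_mk_mk]
  exact h x y

/-- Commutation descends to the separation quotient. -/
theorem commute_descendSQ (T T' : E →ₗ[ℂ] E) (hT : ∀ x, ‖x‖ = 0 → ‖T x‖ = 0)
    (hT' : ∀ x, ‖x‖ = 0 → ‖T' x‖ = 0) (h : Commute T T') :
    Commute (descendSQ T hT) (descendSQ T' hT') := by
  refine LinearMap.ext ?_
  rintro ⟨x⟩
  change SeparationQuotient.mk (T (T' x)) = SeparationQuotient.mk (T' (T x))
  rw [← Module.End.mul_apply, h.eq, Module.End.mul_apply]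

/-- The null-vector condition for a formal adjoint pair, packaged for `descendSQ`. -/
theorem norm_apply_eq_zero_of_isFormalAdjointPair' (T T' : E →ₗ[ℂ] E)
    (h : ∀ x y, inner ℂ (T x) y = inner ℂ x (T' y)) : ∀ x, ‖x‖ = 0 → ‖T x‖ = 0 :=
  fun _ hx => norm_apply_eq_zero_of_adjoint T T' h hx

end Summit.Ventures.HodgeRepro2.SeparationQuotientOperators
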